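import Literature.MathematicalPhysics.QuantumFieldTheory.King1986.MinimizerFourier
import Literature.MathematicalPhysics.QuantumFieldTheory.King1986.AliasingIdentity
import HarnessLib

/-!
# King 1986, (4.44): the TOP-SCALE piece `G^η_{(K)} = C^η − G^η_K = (L^Kη)^{−2}C^ηQ^*_Ka_KQ_KG^η_K` as an operator identity
# on the torus, and the structural identity `C^ηQ^*_K = a_KG^η_KQ^*_K·(Δ^{(K)})⁻¹` that reduces the estimates for
# `C^ηQ^*_K` ((4.45), «easily extend Proposition 3.8») to Proposition 3.8 and the unit-lattice covariance

**Citation header (reproduction of PUBLISHED and PROVED work; seat `pub-ymgap-dag-n18-b` (g2) of the cell `pub-ymgap`,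
Track-A node N18 = NE5 whose PRINTED MODEL of record is King's Prop. 3.8 ∕ 3.9; fourteenth file of the seat's chain —
after Prop. 3.8 (3.71) (files 1–13, all four lines), the remaining printed item of §4 for the propagator decomposition
(2.17) is the last piece `G^η_{(K)}` of p. 675, «Finally, we must establish Propositions 3.7 and 3.9 for G^η_{(K)} =
C^η − G^η_K».  This file types the two operator identities on which that rests; the estimates are the sequel.)**
C. King, *The U(1) Higgs model. I. The continuum limit*, Commun. Math. Phys. **102** (1986) 649–677 [King1986], §4
p. 675 (4.44)–(4.45); §2 (2.13)–(2.17) p. 653; (4.5) p. 670; (4.35) p. 674.  Page image READ AS IMAGE by this seat: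
`b2b-balaban-template/king-renders/1986-cmp102-king-u1-higgs-I-p027-x2.png` (p. 675).  King's paper is TEMPLATE
LITERATURE (printed and proved `A = 0` mechanism); nothing here is about Bałaban's covariant objects.

**What King prints (verbatim, p. 675).**  «Finally, we must establish Propositions 3.7 and 3.9 for G^η_{(K)} = C^η − G^η_K.
It can be written C^η − G^η_K = C^η(a_K(L^Kη)^{−2}Q^*_KQ_K)G^η_K = (L^Kη)^{−2}C^ηQ^*_Ka_KQ_KG^η_K. (4.44)  Furthermore we
obtain the Fourier respresentation for C^εQ^*_K from (4.2) by setting k = K, η = L^{−K} and a = 0: C^εQ^*_K(x, y) =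
(2π)^{−d}∫_{|p′|≦π}dp′Σ_l e^{i(p′+l)(x−y)}u^ε_K(p′+l)Δ^ε(p′+l)^{−1}, (4.45) … We can easily extend Proposition 3.8 to include
(4.45), since the integrand is even simpler than in (4.2). Finally, Proposition 3.9 holds for G^η_{(K)} from the
convergence of C^ηQ^*_K and a_KQ_KG^η_K, and the scalings of the operators.»

**What this file PROVES (kernel).**  Fine torus `Ω_η = Tor (fine N M)`, unit torus `Ω = Tor M`, `B = c(−Δ) + m²`
(`lapF`, King's `η^{−d}(C^η)^{−1}` for `c = N²`), `A₀ = B + a·Q*Q` (`fineOp`; `a_KG_K = aN^dA₀⁻¹` in the tree's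
conventions), `Q = Qmat` the block mean, `Δ_eff = a − a²N^dQA₀⁻¹Qᵀ` (`effLaplacian`, symbol (4.5) = `DeltaEff`):
* §1 **(4.44)** `resolvent_444`: `B⁻¹ − A₀⁻¹ = a·B⁻¹(Q*Q)A₀⁻¹` (`Q*Q = blockProj = N^dQᵀQ`), i.e. `C^η − G^η_K =
  C^η(a_KQ^*_KQ_K)G^η_K` in the tree's normalisation, for `a ≥ 0`, `c ≥ 0`, `m² > 0`.
* §2 **THE STRUCTURAL IDENTITY** `lapF_inv_transpose_Qmat_mul_effLaplacian`: `B⁻¹QᵀΔ_eff = a·A₀⁻¹Qᵀ` (from §1 and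
  King's (2.14) `Δ_eff = a(1 − aN^dQA₀⁻¹Qᵀ)`), hence, `Δ_eff` being invertible (§3), `B⁻¹Qᵀ = a·A₀⁻¹Qᵀ·Δ_eff⁻¹`
  (`lapF_inv_transpose_Qmat`): **`C^ηQ^*_K = (a_KG^η_KQ^*_K)·(Δ^{(K)})⁻¹`** — the row `x ↦ C^ηQ^*_K(x, ·)` of (4.45) is the
  minimiser row `a_KG_KQ_K^*(x, ·)` of (4.2) times the inverse effective Laplacian on the unit lattice, so its size,
  decay and two-spacing rate follow from Proposition 3.8 (files 1–13) and the unit-lattice operator (sequel) instead of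
  King's second Fourier analysis «the integrand is even simpler».
* §3 `DeltaEff_ge_mass` (`Δ^{(K)}(p′) ≥ (a⁻¹ + m⁻²)⁻¹` on the zone: the `l`-sum of (4.5) is `≤ Σ_l|u|²/m² = 1/m²` by
  Parseval `sum_Ur_eq_one` and `Δ^η ≥ m²`), **`effLaplacian_coercive`** (`Δ_eff ≥ (a⁻¹ + m⁻²)⁻¹` as a quadratic form,
  UNIFORMLY in `N` and the torus, via (4.35) `effLaplacian_form_DeltaEff` + Plancherel), `effLaplacian_isUnit`.
* §4 `covQstar N M c m² φ := N^d·B⁻¹Qᵀφ` (King's `C^ηQ^*_Kφ` in the conventions of `minimiser`), `minimiser_apply_eq_sum`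
  (linearity in the block field), **`covQstar_eq_minimiser`** (`C^ηQ^*φ = ℋ(Δ_eff⁻¹φ)`) and the KERNEL FORM
  **`covQstar_kernel_eq_sum`**: `C^ηQ^*_K(x, b) = Σ_{b′} ℋ_K(x, b′)·(Δ^{(K)})⁻¹(b′, b)`.

**NOT COVERED (sequel).**  The decay of `(Δ^{(K)})⁻¹` (Combes–Thomas with §3's coercivity and `UniformDecay.
effLaplacian_decay`), hence Prop. 3.7 ∕ 3.9 for `C^ηQ^*_K` and `G^η_{(K)}`; (4.45) as a Fourier identity (not needed on
this route); even `L`; `A ≠ 0`.  HONEST FRAMING: King's `A = 0` scalar MODEL — template literature, operator identities on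
a finite torus; nothing about Bałaban's covariant objects; nothing continuum ∕ mass-gap ∕ Clay; count-neutral for the
cell's 27 nodes.
-/

noncomputable section

open Finset Real Matrix
open scoped BigOperators

namespace Literature.MathematicalPhysics.QuantumFieldTheory.King1986

open Literature.MathematicalPhysics.QuantumFieldTheory.Balaban1983to89
open Literature.MathematicalPhysics.QuantumFieldTheory.Balaban1983to89.B5Prop11Plancherel

namespace Torus

variable {d : ℕ}

/-! ## §1 (4.44): `C^η − G^η_K = C^η(a_KQ^*_KQ_K)G^η_K` -/

section Identity

variable (N : ℕ) [NeZero N] (M : Fin d → ℕ) [hM : ∀ μ, NeZero (M μ)]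

/-- The resolvent identity behind (4.44): for invertible `A, B`, `B⁻¹ − A⁻¹ = B⁻¹(A − B)A⁻¹`. [folklore] -/
private theorem inv_sub_inv_eq {m : Type*} [Fintype m] [DecidableEq m] (A B : Matrix m m ℝ)
    (hA : IsUnit A.det) (hB : IsUnit B.det) : B⁻¹ - A⁻¹ = B⁻¹ * (A - B) * A⁻¹ := by
  rw [Matrix.mul_sub, Matrix.sub_mul, Matrix.mul_assoc B⁻¹ A A⁻¹, Matrix.mul_nonsing_inv A hA, Matrix.mul_one,
    Matrix.nonsing_inv_mul B hB, Matrix.one_mul]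

/-- `B = c(−Δ) + m²` is invertible for `m² > 0`, `c ≥ 0`. [cite: King1986, (2.16) p.653] -/
theorem lapF_isUnit {c m2 : ℝ} (hc : 0 ≤ c) (hm : 0 < m2) : IsUnit (lapF (fine N M) c m2) :=
  QGQInverse.isUnit_of_coercive hm (lapF_coercive (fine N M) c m2 hc)

/-- **(4.44) on the torus**: `B⁻¹ − A₀⁻¹ = a·B⁻¹(Q*Q)A₀⁻¹` with `B = c(−Δ) + m²`, `A₀ = B + a·Q*Q`, `Q*Q = blockProj`
— King's «C^η − G^η_K = C^η(a_K(L^Kη)^{−2}Q^*_KQ_K)G^η_K» in the tree's normalisation (`a_KG_K = aN^dA₀⁻¹`, `C^η =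
N^dB⁻¹` up to the common `η^d` weights). [cite: King1986, (4.44) p.675] -/
theorem resolvent_444 {a c m2 : ℝ} (ha : 0 ≤ a) (hc : 0 ≤ c) (hm : 0 < m2) :
    (lapF (fine N M) c m2)⁻¹ - (fineOp N M a c m2)⁻¹
      = a • ((lapF (fine N M) c m2)⁻¹ * blockProj N M * (fineOp N M a c m2)⁻¹) := by
  have hA := (Matrix.isUnit_iff_isUnit_det _).mp (fineOp_isUnit N M ha hc hm)
  have hB := (Matrix.isUnit_iff_isUnit_det _).mp (lapF_isUnit N M hc hm)
  rw [inv_sub_inv_eq _ _ hA hB]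
  have hdiff : fineOp N M a c m2 - lapF (fine N M) c m2 = a • blockProj N M := by
    rw [fineOp]; abel
  rw [hdiff, Matrix.mul_smul, Matrix.smul_mul]

/-! ## §2 The structural identity `C^ηQ^*_K·Δ^{(K)} = a_KG^η_KQ^*_K` -/

/-- **`B⁻¹QᵀΔ_eff = a·A₀⁻¹Qᵀ`**: multiply (4.44) on the right by `Qᵀ`, use `Q*Q·A₀⁻¹Qᵀ = N^dQᵀ(QA₀⁻¹Qᵀ)` and King's
(2.14) `Δ_eff = a − a²N^dQA₀⁻¹Qᵀ`. [cite: King1986, (2.14) p.653, (4.44) p.675] -/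
theorem lapF_inv_transpose_Qmat_mul_effLaplacian {a c m2 : ℝ} (ha : 0 ≤ a) (hc : 0 ≤ c) (hm : 0 < m2) :
    (lapF (fine N M) c m2)⁻¹ * (Qmat N M)ᵀ * effLaplacian N M a c m2
      = a • ((fineOp N M a c m2)⁻¹ * (Qmat N M)ᵀ) := by
  set B := lapF (fine N M) c m2 with hBdef
  set A := fineOp N M a c m2 with hAdef
  set Qm := Qmat N M with hQdef
  have hNd : ((N : ℝ) ^ d) ≠ 0 := pow_ne_zero _ (by exact_mod_cast NeZero.ne N)
  -- `N^d·QᵀQ = blockProj`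
  have hP : ((N : ℝ) ^ d) • (Qmᵀ * Qm) = blockProj N M := by
    rw [hQdef, transpose_Qmat_mul_Qmat, smul_smul, mul_inv_cancel₀ hNd, one_smul]
  -- (4.44): `B⁻¹·blockProj·A⁻¹ = a⁻¹(B⁻¹ − A⁻¹)` in the form `a•(B⁻¹ P A⁻¹) = B⁻¹ − A⁻¹`
  have h444 : a • (B⁻¹ * blockProj N M * A⁻¹) = B⁻¹ - A⁻¹ := (resolvent_444 N M ha hc hm).symm
  -- expand `Δ_eff`
  rw [effLaplacian, Matrix.mul_sub, Matrix.mul_smul, Matrix.mul_one, Matrix.mul_smul]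
  have hprod : B⁻¹ * Qmᵀ * (Qm * A⁻¹ * Qmᵀ) = (((N : ℝ) ^ d)⁻¹) • (B⁻¹ * blockProj N M * A⁻¹ * Qmᵀ) := by
    rw [← hP, Matrix.mul_smul, Matrix.smul_mul, Matrix.smul_mul, smul_smul, inv_mul_cancel₀ hNd, one_smul]
    simp only [Matrix.mul_assoc]
  rw [hprod, smul_smul, show a ^ 2 * (N : ℝ) ^ d * ((N : ℝ) ^ d)⁻¹ = a * a by
    rw [mul_assoc, mul_inv_cancel₀ hNd, mul_one, sq], ← smul_smul,
    show a • (B⁻¹ * blockProj N M * A⁻¹ * Qmᵀ) = (a • (B⁻¹ * blockProj N M * A⁻¹)) * Qmᵀ by rw [Matrix.smul_mul],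
    h444, Matrix.sub_mul, smul_sub, sub_sub_cancel]

end Identity

/-! ## §3 The effective Laplacian is coercive uniformly in `N` (mass bound) and invertible -/

/-- **`Δ^{(K)}(p′) ≥ (a⁻¹ + m⁻²)⁻¹`** on the zone `|p′_μ| ≤ π` (`m² > 0`, `N ≥ 1`): in (4.5) every `Δ^η(p′+l) ≥ m²` and
`Σ_l|u(p′+l)|² = 1` (Parseval, `sum_Ur_eq_one`), so `a_K⁻¹ + Σ_l|u|²Δ^{η−1} ≤ a_K⁻¹ + m⁻²` — a volume- and
`K`-independent lower bound (it degenerates with the mass, as it must for the massless model).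
[cite: King1986, (4.5) p.670, (4.35) p.674] -/
theorem DeltaEff_ge_mass {a : ℝ} (ha : 0 < a) {N : ℕ} (hN : 1 ≤ N) {mass : ℝ} (hmass : 0 < mass)
    {p : Fin d → ℝ} (hp : ∀ μ, |p μ| ≤ π) : (a⁻¹ + mass⁻¹)⁻¹ ≤ DeltaEff a N mass p := by
  unfold DeltaEff composedInvResc
  have hterm : ∀ m : Fin d → Fin N,
      B4Strip.Ur N m p * (B4Strip.DeltaXir N mass (B4Strip.shiftr N m p))⁻¹ ≤ B4Strip.Ur N m p * mass⁻¹ := by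
    intro m
    refine mul_le_mul_of_nonneg_left ?_ (B4Strip.Ur_nonneg N m p)
    have hge : mass ≤ B4Strip.DeltaXir N mass (B4Strip.shiftr N m p) := by
      have h0 := B4Strip.DeltaXir_nonneg N 0 le_rfl (B4Strip.shiftr N m p)
      unfold B4Strip.DeltaXir at h0 ⊢
      linarith
    exact inv_anti₀ hmass hge
  have hsum : ∑ m : Fin d → Fin N, B4Strip.Ur N m p * (B4Strip.DeltaXir N mass (B4Strip.shiftr N m p))⁻¹ ≤ mass⁻¹ := by
    calc _ ≤ ∑ m : Fin d → Fin N, B4Strip.Ur N m p * mass⁻¹ := Finset.sum_le_sum fun m _ => hterm m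
      _ = (∑ m : Fin d → Fin N, B4Strip.Ur N m p) * mass⁻¹ := by rw [Finset.sum_mul]
      _ = mass⁻¹ := by rw [sum_Ur_eq_one hN hp, one_mul]
  have hpos : 0 < a⁻¹ + ∑ m : Fin d → Fin N,
      B4Strip.Ur N m p * (B4Strip.DeltaXir N mass (B4Strip.shiftr N m p))⁻¹ := by
    have h1 : 0 ≤ ∑ m : Fin d → Fin N, B4Strip.Ur N m p * (B4Strip.DeltaXir N mass (B4Strip.shiftr N m p))⁻¹ :=
      Finset.sum_nonneg fun m _ =>
        mul_nonneg (B4Strip.Ur_nonneg N m p) (inv_nonneg.mpr (B4Strip.DeltaXir_nonneg N mass hmass.le _))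
    have h2 : 0 < a⁻¹ := inv_pos.mpr ha
    linarith
  exact inv_anti₀ hpos (by linarith)

section Coercive

variable (N : ℕ) [NeZero N] (M : Fin d → ℕ) [hM : ∀ μ, NeZero (M μ)]

/-- **`Δ^{(K)} ≥ (a⁻¹ + m⁻²)⁻¹` as a quadratic form on the unit torus, uniformly in `N = L^K` and the torus**: (4.35)
(`effLaplacian_form_DeltaEff`) with `DeltaEff_ge_mass` and Plancherel. [cite: King1986, (4.33)–(4.35) p.674] -/
theorem effLaplacian_coercive (hN1 : 1 ≤ N) {a m2 : ℝ} (ha : 0 < a) (hm : 0 < m2) :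
    QGQInverse.Coercive (effLaplacian N M a ((N : ℝ) ^ 2) m2) ((a⁻¹ + m2⁻¹)⁻¹) := by
  intro φ
  have hcard : (0 : ℝ) < Fintype.card (Tor M) := by exact_mod_cast Fintype.card_pos
  have hform := effLaplacian_form_DeltaEff N M hN1 ha hm φ
  have hpar := parseval_dot M φ
  have hsum : (a⁻¹ + m2⁻¹)⁻¹ * ∑ q : Tor M, ‖ft M φ q‖ ^ 2
      ≤ ∑ q : Tor M, DeltaEff a N m2 (sOf M q) * ‖ft M φ q‖ ^ 2 := by
    rw [Finset.mul_sum]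
    exact Finset.sum_le_sum fun q _ =>
      mul_le_mul_of_nonneg_right (DeltaEff_ge_mass ha hN1 hm (abs_sOf_le M q)) (sq_nonneg _)
  rw [← hpar, ← hform, ← mul_assoc, mul_comm ((a⁻¹ + m2⁻¹)⁻¹), mul_assoc] at hsum
  exact le_of_mul_le_mul_left hsum hcard

/-- Hence `Δ^{(K)}` is invertible (`m² > 0`). [cite: King1986, (2.16) p.653] -/
theorem effLaplacian_isUnit (hN1 : 1 ≤ N) {a m2 : ℝ} (ha : 0 < a) (hm : 0 < m2) :
    IsUnit (effLaplacian N M a ((N : ℝ) ^ 2) m2) :=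
  QGQInverse.isUnit_of_coercive (by positivity) (effLaplacian_coercive N M hN1 ha hm)

/-- **`C^ηQ^*_K = a_KG^η_KQ^*_K·(Δ^{(K)})⁻¹`**: `B⁻¹Qᵀ = a·A₀⁻¹QᵀΔ_eff⁻¹` (for `c = N²`, `a > 0`, `m² > 0`).
[cite: King1986, (4.44)–(4.45) p.675, (2.14) p.653] -/
theorem lapF_inv_transpose_Qmat (hN1 : 1 ≤ N) {a m2 : ℝ} (ha : 0 < a) (hm : 0 < m2) :
    (lapF (fine N M) ((N : ℝ) ^ 2) m2)⁻¹ * (Qmat N M)ᵀ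
      = a • ((fineOp N M a ((N : ℝ) ^ 2) m2)⁻¹ * (Qmat N M)ᵀ * (effLaplacian N M a ((N : ℝ) ^ 2) m2)⁻¹) := by
  have hΔ := (Matrix.isUnit_iff_isUnit_det _).mp (effLaplacian_isUnit N M hN1 ha hm)
  have h := lapF_inv_transpose_Qmat_mul_effLaplacian N M (c := (N : ℝ) ^ 2) ha.le (by positivity) hm
  have h2 : (lapF (fine N M) ((N : ℝ) ^ 2) m2)⁻¹ * (Qmat N M)ᵀ * effLaplacian N M a ((N : ℝ) ^ 2) m2
      * (effLaplacian N M a ((N : ℝ) ^ 2) m2)⁻¹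
      = a • ((fineOp N M a ((N : ℝ) ^ 2) m2)⁻¹ * (Qmat N M)ᵀ) * (effLaplacian N M a ((N : ℝ) ^ 2) m2)⁻¹ := by
    rw [h]
  rwa [Matrix.mul_assoc ((lapF (fine N M) ((N : ℝ) ^ 2) m2)⁻¹ * (Qmat N M)ᵀ), Matrix.mul_nonsing_inv _ hΔ,
    Matrix.mul_one, Matrix.smul_mul] at h2

/-! ## §4 `C^ηQ^*_K` in the conventions of `minimiser`, and its kernel as `ℋ_K·(Δ^{(K)})⁻¹` -/

/-- King's `C^ηQ^*_Kφ` in the conventions of `minimiser` (`ℋ_K = a_KG_KQ_K^* = (aN^d)•A₀⁻¹Qᵀ`): `N^d•B⁻¹Qᵀφ` with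
`B = c(−Δ) + m²`. [cite: King1986, (4.44)–(4.45) p.675] -/
def covQstar (c m2 : ℝ) (φ : Tor M → ℝ) : Tor (fine N M) → ℝ :=
  ((N : ℝ) ^ d) • ((lapF (fine N M) c m2)⁻¹ *ᵥ ((Qmat N M)ᵀ *ᵥ φ))

/-- **`C^ηQ^*_Kφ = ℋ_K(Δ_eff⁻¹φ)`** (`c = N²`, `a > 0`, `m² > 0`). [cite: King1986, (4.44)–(4.45) p.675] -/
theorem covQstar_eq_minimiser (hN1 : 1 ≤ N) {a m2 : ℝ} (ha : 0 < a) (hm : 0 < m2) (φ : Tor M → ℝ) :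
    covQstar N M ((N : ℝ) ^ 2) m2 φ
      = minimiser N M a ((N : ℝ) ^ 2) m2 ((effLaplacian N M a ((N : ℝ) ^ 2) m2)⁻¹ *ᵥ φ) := by
  rw [covQstar, minimiser, Matrix.mulVec_mulVec, Matrix.mulVec_mulVec, Matrix.mulVec_mulVec,
    lapF_inv_transpose_Qmat N M hN1 ha hm, Matrix.smul_mulVec, smul_smul, mul_comm ((N : ℝ) ^ d) a]

/-- The minimiser is linear in the block field: `ℋ(ψ)(x) = Σ_{b′} ψ(b′)·ℋ(δ_{b′})(x)`. [cite: King1986, (2.15) p.653] -/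
theorem minimiser_apply_eq_sum (a c m2 : ℝ) (ψ : Tor M → ℝ) (x : Tor (fine N M)) :
    minimiser N M a c m2 ψ x = ∑ b' : Tor M, ψ b' * minimiser N M a c m2 (Pi.single b' 1) x := by
  unfold minimiser
  rw [Matrix.mulVec_mulVec, Pi.smul_apply, smul_eq_mul, Matrix.mulVec, dotProduct, Finset.mul_sum]
  refine Finset.sum_congr rfl fun b' _ => ?_
  rw [Matrix.mulVec_mulVec, Pi.smul_apply, smul_eq_mul, Matrix.mulVec_single_one, Matrix.col_apply]
  ring

/-- **THE KERNEL FORM `C^ηQ^*_K(x, b) = Σ_{b′} ℋ_K(x, b′)·(Δ^{(K)})⁻¹(b′, b)`**: the row of (4.45) at the fine point `x` is the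
minimiser row of (4.2) composed with the inverse effective Laplacian on the unit lattice (`c = N²`, `a > 0`, `m² > 0`).
[cite: King1986, (4.44)–(4.45) p.675] -/
theorem covQstar_kernel_eq_sum (hN1 : 1 ≤ N) {a m2 : ℝ} (ha : 0 < a) (hm : 0 < m2) (b : Tor M)
    (x : Tor (fine N M)) :
    covQstar N M ((N : ℝ) ^ 2) m2 (Pi.single b 1) x
      = ∑ b' : Tor M, (effLaplacian N M a ((N : ℝ) ^ 2) m2)⁻¹ b' b
          * minimiser N M a ((N : ℝ) ^ 2) m2 (Pi.single b' 1) x := by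
  rw [covQstar_eq_minimiser N M hN1 ha hm, minimiser_apply_eq_sum]
  refine Finset.sum_congr rfl fun b' _ => ?_
  rw [Matrix.mulVec_single_one, Matrix.col_apply]

end Coercive

end Torus

end Literature.MathematicalPhysics.QuantumFieldTheory.King1986
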